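import Literature.NumberTheory.GelbartRogawski1991.DoubledWeilRepresentationUndoubling
import Literature.NumberTheory.GelbartRogawski1991.UnitaryDualPairSeesawConjSplittingLeft
import Literature.NumberTheory.Automorphic.UnitaryGroupSeesawConjugation
import Literature.NumberTheory.Automorphic.UnitaryGroupSeesawConjugationLeft
import Literature.NumberTheory.Automorphic.UnitaryGroupReindexIsometry
import Literature.NumberTheory.Automorphic.UnitaryGroupLevelTransport
import HarnessLib

/-!
# The doubled Kronecker conjugation datum (I): the matrices `kronA = reindex_e (a ⊗ 1)`, `kronAD = kronA ⊕ kronA`, the relabellings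
# `relabC`, `relabCD`, the conjugation `thetaD = Ad(kronAD) : H′(𝔸) →* H(𝔸)`, the doubled see-saw element `seesawD` and its
# `Θ`-fixing Weil lift `rD`, and the group-side square `thetaD_square`

Cell `hodgecm-mathlib`, GS-6 (β) glue, node (T) «frame independence of `ω(μ,ε,χ)`», piece (T1ᴰ) = the MODEL INSTANTIATION of the
doubled conjugation datum (placement row L-13b, wave 2).  Phase-A bytes of record: `A-plan/gs6-glue/T1D-modelInstantiation.A-p06g11.lean`
v3 sha16 54c3fde381223f81 (A-p06 g11; heir A-p15 g8, v4 117472700602f9d5), declarations byte-identical up to (i) `[folklore]` → `[cite:]`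
docstring tags and (ii) the local notations `𝔸⁺`/`𝔸L` expanded to `(AdeleRing (𝓞 (Fp L)) (Fp L))`/`(AdeleRing (𝓞 L) L)` (no notation in
Literature files).  HC_CM is proved only modulo the 7 printed citations until rung 0 closes.

MODEL: CM field `L`, `L⁺ = Fp L`, frames `dV, dV′ : Fin N → L`, `dW : Fin M → L`, `e : Fin N × Fin M ≃ Fin n`; an adelic isometry
`a : (V ⊗ 𝔸, diag dV′) ≅ (V ⊗ 𝔸, diag dV)` (`ha`), rational (`haa₀`); a relabelling `C`, `(T_V ⊗ T_W) C = T_V′ ⊗ T_W` (`hC`), rational (`hCC₀`).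
* §2 `kronA e a = reindex_e (a ⊗ 1_W)`, `kronAD e a = reindex_{e₂} (kronA ⊕ kronA)` (the doubled Kronecker matrix `M̃ ⊕ M̃` of a rational
  isometry), `relabC`, `relabCD`, and their isometry / relabelling identities for `reindex e e (J_V ⊗ J_W)`, `J^𝔻`, `gramA`, `gramDA`;
* §3 **`thetaD := adelicIsometryConj (kronAD e a) : H′(𝔸) →* H(𝔸)`**, **(u1) `thetaD_inlG`** (`θD (g′ ⊕ 1) = (θ g′) ⊕ 1`,
  `θ = adelicPairIsometryConjLeft a ha`), **`isSiegelDelta_thetaD` / `detDelta_thetaD`** (`P_Δ` and `det_Δ` are preserved);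
* §4 **`seesawD = Res(kronAD) ∘ Λ_{relabCD}⁻¹ ∈ Sp(𝕎^𝔻)(𝔸)`** (rational: `seesawD_mem_range`), **`rD := r_F(seesawD) ∈ Mp(𝕎^𝔻)ᶜᵒⁿᵗ`**,
  `projD_rD`, `rD_mem_adelicMpTheta`, `undoubleIdx_rD_mem_adelicMpTheta`, base change `coe_*_map`, and **`thetaD_square`** (★ `seesawConj_conj_toSymplectic`).

## References
[Kudla1984] S. Kudla, *Seesaw dual reductive pairs*, Progr. Math. 46 (1984), §1 · [Kudla1994] S. S. Kudla, Israel J. Math. 87 (1994), §2,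
Thm. 3.1 · [GelbartRogawski1991] S. Gelbart, J. Rogawski, Invent. Math. 105 (1991), §3.1 p. 454, Prop. 3.1.1 p. 455 · [Weil1964] A. Weil, Acta
Math. 111 (1964), Chap. III n° 40 p. 190, n° 41 Thm 6 p. 193 · [MoeglinVignerasWaldspurger1987] LNM 1291 (1987), Chap. 2 II.1 ·
[PlatonovRapinchuk1994] V. Platonov, A. Rapinchuk, *Algebraic Groups and Number Theory* (1994), §2.3, §5.1.
-/

set_option autoImplicit false

noncomputable section

open scoped Classical
open scoped Matrix Kronecker
open NumberField IsDedekindDomain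
open Literature.RepresentationTheory.HeisenbergGroup
open Literature.RepresentationTheory.HeisenbergGroup.SymplecticMatrix (transportSp mapHom)
open Literature.NumberTheory.Automorphic
open Literature.NumberTheory.Weil1964
open Literature.NumberTheory.GaloisRepresentations

namespace Literature.NumberTheory.GelbartRogawski1991.GRConstruction

open UnitaryDualPair
open Literature.NumberTheory.Automorphic.UnitaryGroup

variable (L : Type) [Field L] [NumberField L] [IsCMField L]
  {N M n : ℕ} (e : Fin N × Fin M ≃ Fin n)
  (dV : Fin N → L) (hdV : ∀ i, IsCMField.complexConj L (dV i) = dV i) (hdV0 : ∀ i, dV i ≠ 0)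
  (dV' : Fin N → L) (hdV' : ∀ i, IsCMField.complexConj L (dV' i) = dV' i) (hdV'0 : ∀ i, dV' i ≠ 0)
  (dW : Fin M → L) (hdW : ∀ i, IsCMField.complexConj L (dW i) = dW i) (hdW0 : ∀ i, dW i ≠ 0)

/-! # §2 The Kronecker matrices `kronA = reindex_e (a ⊗ 1)`, `kronAD = kronA ⊕ kronA` and the relabellings `relabC`, `relabCD` -/

section Matrices

/-- **`a ⊗ 1_W` in the enumeration `e`**: `reindexGL e (kroneckerGL (a, 1)) ∈ GL_n(𝔸_L)`. [cite: Kudla1984, §1] -/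
def kronA {S : Type*} [CommRing S] (a : GL (Fin N) S) : GL (Fin n) S :=
  reindexGL e (kroneckerGL (a, (1 : GL (Fin M) S)))

/-- **the doubled Kronecker matrix `(a ⊗ 1) ⊕ (a ⊗ 1)` on `𝔻 = 𝕍 ⊕ 𝕍`** (enumeration `e₂`). [cite: Kudla1994, §2 (doubled space, Siegel parabolic), Thm. 3.1] -/
def kronAD {S : Type*} [CommRing S] (a : GL (Fin N) S) : GL (Fin (n + n)) S :=
  reindexGL (e₂ (n := n)) (blockDiagGL (kronA e a, kronA e a))

/-- the relabelling matrix in the enumeration `e`: `reindexGL e C ∈ GL_n(𝔸_{L⁺})`. [cite: Kudla1984, §1] -/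
def relabC {S : Type*} [CommRing S] (C : GL (Fin N × Fin M) S) : GL (Fin n) S :=
  reindexGL e C

/-- the doubled relabelling matrix `reindex_{e₂} (C̃ ⊕ C̃) ∈ GL_{n+n}(𝔸_{L⁺})`. [cite: Kudla1994, §2 (doubled space, Siegel parabolic), Thm. 3.1] -/
def relabCD {S : Type*} [CommRing S] (C : GL (Fin N × Fin M) S) : GL (Fin (n + n)) S :=
  reindexGL (e₂ (n := n)) (blockDiagGL (relabC e C, relabC e C))

/-- unfolding. [cite: Kudla1984, §1] -/
theorem kronA_def {S : Type*} [CommRing S] (a : GL (Fin N) S) : kronA e a = reindexGL e (kroneckerGL (a, (1 : GL (Fin M) S))) := rfl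

/-- unfolding. [cite: Kudla1984, §1] -/
theorem kronAD_def {S : Type*} [CommRing S] (a : GL (Fin N) S) :
    kronAD e a = reindexGL (e₂ (n := n)) (blockDiagGL (kronA e a, kronA e a)) := rfl

/-- unfolding. [cite: Kudla1984, §1] -/
theorem relabC_def {S : Type*} [CommRing S] (C : GL (Fin N × Fin M) S) : relabC e C = reindexGL e C := rfl

/-- unfolding. [cite: Kudla1984, §1] -/
theorem relabCD_def {S : Type*} [CommRing S] (C : GL (Fin N × Fin M) S) :
    relabCD e C = reindexGL (e₂ (n := n)) (blockDiagGL (relabC e C, relabC e C)) := rfl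

/-- **`kronA` is an isometry `reindex_e (J_V′ ⊗ J_W) → reindex_e (J_V ⊗ J_W)` of the adelic forms** (`pairFormA`).
[cite: Kudla1984, §1] -/
theorem kronA_isometry (a : GL (Fin N) (AdeleRing (𝓞 L) L))
    (ha : ((a : Matrix (Fin N) (Fin N) (AdeleRing (𝓞 L) L)).map (conjAdele (Fp L) L (IsCMField.complexConj L)))ᵀ *
        adelicForm L N (Matrix.diagonal dV) * a = adelicForm L N (Matrix.diagonal dV')) :
    (((kronA e a : GL (Fin n) (AdeleRing (𝓞 L) L)) : Matrix (Fin n) (Fin n) (AdeleRing (𝓞 L) L)).map (conjAdele (Fp L) L (IsCMField.complexConj L)))ᵀ *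
        Matrix.reindex e e (pairFormA L dV dW) * (kronA e a : GL (Fin n) (AdeleRing (𝓞 L) L)) = Matrix.reindex e e (pairFormA L dV' dW) :=
  isometry_reindexGL _ e _ (kroneckerGL_isometry_one _ a ha (adelicForm L M (Matrix.diagonal dW)))

/-- **`kronAD` is an isometry `J^𝔻[dV′] → J^𝔻[dV]` of the doubled adelic forms** (`adelicForm_hermD_eq`: `J^𝔻 = reindex_{e₂}(J̃ ⊕ −J̃)`).
[cite: Kudla1994, §2 (doubled space, Siegel parabolic), Thm. 3.1] -/
theorem kronAD_isometry (a : GL (Fin N) (AdeleRing (𝓞 L) L))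
    (ha : ((a : Matrix (Fin N) (Fin N) (AdeleRing (𝓞 L) L)).map (conjAdele (Fp L) L (IsCMField.complexConj L)))ᵀ *
        adelicForm L N (Matrix.diagonal dV) * a = adelicForm L N (Matrix.diagonal dV')) :
    (((kronAD e a : GL (Fin (n + n)) (AdeleRing (𝓞 L) L)) : Matrix (Fin (n + n)) (Fin (n + n)) (AdeleRing (𝓞 L) L)).map
          (conjAdele (Fp L) L (IsCMField.complexConj L)))ᵀ *
        adelicForm L (n + n) (hermD L e dV hdV dW hdW) * (kronAD e a : GL (Fin (n + n)) (AdeleRing (𝓞 L) L)) =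
      adelicForm L (n + n) (hermD L e dV' hdV' dW hdW) := by
  rw [adelicForm_hermD_eq, adelicForm_hermD_eq]
  exact isometry_reindexGL _ _ _
    (isometry_blockDiagGL _ _ _ (kronA_isometry L e dV dV' dW a ha) (isometry_neg _ (kronA_isometry L e dV dV' dW a ha)))

/-- **`gramA · relabC = gramA′`** from `(T_V ⊗ T_W) C = T_V′ ⊗ T_W` ((T4u)'s `hC`). [cite: Kudla1984, §1] -/
theorem gramA_mul_relabC (C : GL (Fin N × Fin M) (AdeleRing (𝓞 (Fp L)) (Fp L)))
    (hC : (realDiagonal L dV hdV).map (algebraMap (Fp L) (AdeleRing (𝓞 (Fp L)) (Fp L))) ⊗ₖ (realDiagonal L dW hdW).map (algebraMap (Fp L) (AdeleRing (𝓞 (Fp L)) (Fp L))) *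
        (C : Matrix (Fin N × Fin M) (Fin N × Fin M) (AdeleRing (𝓞 (Fp L)) (Fp L))) =
      (realDiagonal L dV' hdV').map (algebraMap (Fp L) (AdeleRing (𝓞 (Fp L)) (Fp L))) ⊗ₖ (realDiagonal L dW hdW).map (algebraMap (Fp L) (AdeleRing (𝓞 (Fp L)) (Fp L)))) :
    gramA L e dV hdV dW hdW * ((relabC e C : GL (Fin n) (AdeleRing (𝓞 (Fp L)) (Fp L))) : Matrix (Fin n) (Fin n) (AdeleRing (𝓞 (Fp L)) (Fp L))) = gramA L e dV' hdV' dW hdW := by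
  show Matrix.reindex e e _ * _ = Matrix.reindex e e _
  rw [relabC_def, reindex_mul_coe_reindexGL, hC]

/-- `gramDA = reindex_{e₂} (gramA ⊕ −gramA)` (★ `gramS_mul_one` read backwards). [cite: Kudla1994, §2 (doubled space, Siegel parabolic), Thm. 3.1] -/
theorem gramDA_eq_reindex_gramS :
    gramDA L e dV hdV dW hdW = Matrix.reindex (e₂ (n := n)) (e₂ (n := n)) (gramS L e dV hdV dW hdW) := by
  have h := gramS_mul_one L e dV hdV dW hdW
  rw [Units.val_one, Matrix.mul_one] at h
  rw [h, Matrix.reindex_apply, Matrix.reindex_apply, Matrix.submatrix_submatrix, Equiv.symm_symm, Equiv.self_comp_symm,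
    Matrix.submatrix_id_id]

/-- **`gramDA · relabCD = gramDA′`** (B-p08's `hC` for the doubled relabelling). [cite: Kudla1994, §2 (doubled space, Siegel parabolic), Thm. 3.1] -/
theorem gramDA_mul_relabCD (C : GL (Fin N × Fin M) (AdeleRing (𝓞 (Fp L)) (Fp L)))
    (hC : (realDiagonal L dV hdV).map (algebraMap (Fp L) (AdeleRing (𝓞 (Fp L)) (Fp L))) ⊗ₖ (realDiagonal L dW hdW).map (algebraMap (Fp L) (AdeleRing (𝓞 (Fp L)) (Fp L))) *
        (C : Matrix (Fin N × Fin M) (Fin N × Fin M) (AdeleRing (𝓞 (Fp L)) (Fp L))) =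
      (realDiagonal L dV' hdV').map (algebraMap (Fp L) (AdeleRing (𝓞 (Fp L)) (Fp L))) ⊗ₖ (realDiagonal L dW hdW).map (algebraMap (Fp L) (AdeleRing (𝓞 (Fp L)) (Fp L)))) :
    gramDA L e dV hdV dW hdW * ((relabCD e C : GL (Fin (n + n)) (AdeleRing (𝓞 (Fp L)) (Fp L))) : Matrix (Fin (n + n)) (Fin (n + n)) (AdeleRing (𝓞 (Fp L)) (Fp L))) =
      gramDA L e dV' hdV' dW hdW := by
  rw [gramDA_eq_reindex_gramS, gramDA_eq_reindex_gramS, relabCD_def, reindex_mul_coe_reindexGL, gramS,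
    fromBlocks_mul_coe_blockDiagGL, Matrix.neg_mul, gramA_mul_relabC L e dV hdV dV' hdV' dW hdW C hC]

end Matrices

/-! # §3 `thetaD = Ad(kronAD) : H′(𝔸) →* H(𝔸)`, (u1) `thetaD_inlG`, and the Siegel bookkeeping `hθΔ`, `hθdet` -/

section Theta

/-- **`θ^𝔻 := Ad((a ⊗ 1) ⊕ (a ⊗ 1)) : H′(𝔸) = U(J^𝔻[dV′])(𝔸) →* H(𝔸) = U(J^𝔻[dV])(𝔸)`** — B-p08's (T4) binder `θ` in the model.
[cite: Kudla1994, §2 (doubled space, Siegel parabolic), Thm. 3.1] -/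
def thetaD (a : GL (Fin N) (AdeleRing (𝓞 L) L))
    (ha : ((a : Matrix (Fin N) (Fin N) (AdeleRing (𝓞 L) L)).map (conjAdele (Fp L) L (IsCMField.complexConj L)))ᵀ *
        adelicForm L N (Matrix.diagonal dV) * a = adelicForm L N (Matrix.diagonal dV')) :
    HA L e dV' hdV' dW hdW →* HA L e dV hdV dW hdW :=
  adelicIsometryConj (Fp L) L (IsCMField.complexConj L) (n + n) (kronAD e a)
    (kronAD_isometry L e dV hdV dV' hdV' dW hdW a ha)

variable {L e dV hdV dV' hdV' dW hdW}

/-- underlying matrix: `θ^𝔻(p) = kronAD · p · kronAD⁻¹`. [cite: PlatonovRapinchuk1994, §5.1] -/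
@[simp] theorem coe_thetaD (a : GL (Fin N) (AdeleRing (𝓞 L) L))
    (ha : ((a : Matrix (Fin N) (Fin N) (AdeleRing (𝓞 L) L)).map (conjAdele (Fp L) L (IsCMField.complexConj L)))ᵀ *
        adelicForm L N (Matrix.diagonal dV) * a = adelicForm L N (Matrix.diagonal dV')) (p : HA L e dV' hdV' dW hdW) :
    ((thetaD L e dV hdV dV' hdV' dW hdW a ha p : HA L e dV hdV dW hdW) : GL (Fin (n + n)) (AdeleRing (𝓞 L) L)) =
      kronAD e a * (p : GL (Fin (n + n)) (AdeleRing (𝓞 L) L)) * (kronAD e a)⁻¹ :=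
  rfl

/-- **(u1) `θ^𝔻 (g′ ⊕ 1) = (θ g′) ⊕ 1`** with `θ = adelicPairIsometryConjLeft a ha = Ad(a ⊗ 1)` ((T4u) e96f661a `hθ`, token for token).
[cite: Kudla1994, §2 (doubled space, Siegel parabolic), Thm. 3.1] -/
theorem thetaD_inlG (a : GL (Fin N) (AdeleRing (𝓞 L) L))
    (ha : ((a : Matrix (Fin N) (Fin N) (AdeleRing (𝓞 L) L)).map (conjAdele (Fp L) L (IsCMField.complexConj L)))ᵀ *
        adelicForm L N (Matrix.diagonal dV) * a = adelicForm L N (Matrix.diagonal dV'))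
    (g' : adelicPair (Fp L) L (IsCMField.complexConj L) N M (Matrix.diagonal dV') (Matrix.diagonal dW)) :
    thetaD L e dV hdV dV' hdV' dW hdW a ha (inlG L e dV' hdV' dW hdW g') =
      inlG L e dV hdV dW hdW (adelicPairIsometryConjLeft (Fp L) L (IsCMField.complexConj L) N M a ha g') := by
  refine Subtype.ext ?_
  rw [coe_thetaD, coe_inlG, coe_inlG, coe_adelicPairIsometryConjLeft, kronAD_def, kronA_def, ← map_inv, ← map_mul, ← map_mul,
    ← map_inv, ← map_mul, ← map_mul, Prod.inv_mk, Prod.mk_mul_mk, Prod.mk_mul_mk, mul_one, mul_inv_cancel, ← map_inv,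
    ← map_mul, ← map_mul]

/-- the doubling blocks of `θ^𝔻(p)`: `blk (θ^𝔻 p) = diag(Ã, Ã) · blk p · diag(Ã, Ã)⁻¹`, `Ã = kronA e a`. [cite: Kudla1994, §2 (doubled space, Siegel parabolic), Thm. 3.1] -/
theorem blk_thetaD (a : GL (Fin N) (AdeleRing (𝓞 L) L))
    (ha : ((a : Matrix (Fin N) (Fin N) (AdeleRing (𝓞 L) L)).map (conjAdele (Fp L) L (IsCMField.complexConj L)))ᵀ *
        adelicForm L N (Matrix.diagonal dV) * a = adelicForm L N (Matrix.diagonal dV')) (p : HA L e dV' hdV' dW hdW) :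
    blk L e dV hdV dW hdW (thetaD L e dV hdV dV' hdV' dW hdW a ha p) =
      Matrix.fromBlocks ((kronA e a : GL (Fin n) (AdeleRing (𝓞 L) L)) : Matrix (Fin n) (Fin n) (AdeleRing (𝓞 L) L)) 0 0 (kronA e a : GL (Fin n) (AdeleRing (𝓞 L) L)) *
        blk L e dV' hdV' dW hdW p *
        Matrix.fromBlocks (((kronA e a)⁻¹ : GL (Fin n) (AdeleRing (𝓞 L) L)) : Matrix (Fin n) (Fin n) (AdeleRing (𝓞 L) L)) 0 0 ((kronA e a)⁻¹ : GL (Fin n) (AdeleRing (𝓞 L) L)) := by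
  have hp : ((p : HA L e dV' hdV' dW hdW) : GL (Fin (n + n)) (AdeleRing (𝓞 L) L)).val =
      Matrix.reindex (e₂ (n := n)) (e₂ (n := n)) (blk L e dV' hdV' dW hdW p) := by
    simp only [blk, Matrix.reindex_apply, Matrix.submatrix_submatrix, Equiv.symm_symm, Equiv.self_comp_symm,
      Matrix.submatrix_id_id]
  have hinv : ((kronAD e a)⁻¹ : GL (Fin (n + n)) (AdeleRing (𝓞 L) L)) =
      reindexGL (e₂ (n := n)) (blockDiagGL ((kronA e a)⁻¹, (kronA e a)⁻¹)) := by
    rw [kronAD_def, ← map_inv, ← map_inv, Prod.inv_mk]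
  show Matrix.reindex (e₂ (n := n)).symm (e₂ (n := n)).symm
      (((kronAD e a : GL (Fin (n + n)) (AdeleRing (𝓞 L) L)) : Matrix (Fin (n + n)) (Fin (n + n)) (AdeleRing (𝓞 L) L)) *
        ((p : HA L e dV' hdV' dW hdW) : GL (Fin (n + n)) (AdeleRing (𝓞 L) L)).val *
        (((kronAD e a)⁻¹ : GL (Fin (n + n)) (AdeleRing (𝓞 L) L)) : Matrix (Fin (n + n)) (Fin (n + n)) (AdeleRing (𝓞 L) L))) = _
  rw [hinv, kronAD_def, coe_reindexGL, coe_reindexGL, coe_blockDiagGL, coe_blockDiagGL, hp, Matrix.reindex_apply,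
    Matrix.reindex_apply, Matrix.reindex_apply, Matrix.reindex_apply, Matrix.submatrix_mul_equiv, Matrix.submatrix_mul_equiv,
    Matrix.submatrix_submatrix, Equiv.symm_symm, Equiv.symm_comp_self, Matrix.submatrix_id_id]

/-- the four doubling blocks of `θ^𝔻(p)` are the `Ad(Ã)`-conjugates of those of `p`. [cite: Kudla1994, §2 (doubled space, Siegel parabolic), Thm. 3.1] -/
theorem blk_thetaD_eq_fromBlocks (a : GL (Fin N) (AdeleRing (𝓞 L) L))
    (ha : ((a : Matrix (Fin N) (Fin N) (AdeleRing (𝓞 L) L)).map (conjAdele (Fp L) L (IsCMField.complexConj L)))ᵀ *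
        adelicForm L N (Matrix.diagonal dV) * a = adelicForm L N (Matrix.diagonal dV')) (p : HA L e dV' hdV' dW hdW) :
    blk L e dV hdV dW hdW (thetaD L e dV hdV dV' hdV' dW hdW a ha p) =
      Matrix.fromBlocks
        (((kronA e a : GL (Fin n) (AdeleRing (𝓞 L) L)) : Matrix (Fin n) (Fin n) (AdeleRing (𝓞 L) L)) * (blk L e dV' hdV' dW hdW p).toBlocks₁₁ *
          (((kronA e a)⁻¹ : GL (Fin n) (AdeleRing (𝓞 L) L)) : Matrix (Fin n) (Fin n) (AdeleRing (𝓞 L) L)))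
        (((kronA e a : GL (Fin n) (AdeleRing (𝓞 L) L)) : Matrix (Fin n) (Fin n) (AdeleRing (𝓞 L) L)) * (blk L e dV' hdV' dW hdW p).toBlocks₁₂ *
          (((kronA e a)⁻¹ : GL (Fin n) (AdeleRing (𝓞 L) L)) : Matrix (Fin n) (Fin n) (AdeleRing (𝓞 L) L)))
        (((kronA e a : GL (Fin n) (AdeleRing (𝓞 L) L)) : Matrix (Fin n) (Fin n) (AdeleRing (𝓞 L) L)) * (blk L e dV' hdV' dW hdW p).toBlocks₂₁ *
          (((kronA e a)⁻¹ : GL (Fin n) (AdeleRing (𝓞 L) L)) : Matrix (Fin n) (Fin n) (AdeleRing (𝓞 L) L)))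
        (((kronA e a : GL (Fin n) (AdeleRing (𝓞 L) L)) : Matrix (Fin n) (Fin n) (AdeleRing (𝓞 L) L)) * (blk L e dV' hdV' dW hdW p).toBlocks₂₂ *
          (((kronA e a)⁻¹ : GL (Fin n) (AdeleRing (𝓞 L) L)) : Matrix (Fin n) (Fin n) (AdeleRing (𝓞 L) L))) := by
  rw [blk_thetaD]
  conv_lhs => rw [← Matrix.fromBlocks_toBlocks (blk L e dV' hdV' dW hdW p)]
  rw [Matrix.fromBlocks_multiply, Matrix.fromBlocks_multiply]
  simp only [Matrix.zero_mul, Matrix.mul_zero, add_zero, zero_add]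

/-- **`θ^𝔻` maps `P_Δ′(𝔸)` into `P_Δ(𝔸)`** (B-p08's `hθΔ`): `Ad(Ã ⊕ Ã)` stabilises the diagonal `Δ`.
[cite: Kudla1994, §2 (doubled space, Siegel parabolic), Thm. 3.1] -/
theorem isSiegelDelta_thetaD (a : GL (Fin N) (AdeleRing (𝓞 L) L))
    (ha : ((a : Matrix (Fin N) (Fin N) (AdeleRing (𝓞 L) L)).map (conjAdele (Fp L) L (IsCMField.complexConj L)))ᵀ *
        adelicForm L N (Matrix.diagonal dV) * a = adelicForm L N (Matrix.diagonal dV')) (p : HA L e dV' hdV' dW hdW)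
    (hp : IsSiegelDelta L e dV' hdV' dW hdW p) : IsSiegelDelta L e dV hdV dW hdW (thetaD L e dV hdV dV' hdV' dW hdW a ha p) := by
  unfold IsSiegelDelta at hp ⊢
  rw [blk_thetaD_eq_fromBlocks, Matrix.toBlocks_fromBlocks₁₁, Matrix.toBlocks_fromBlocks₁₂, Matrix.toBlocks_fromBlocks₂₁,
    Matrix.toBlocks_fromBlocks₂₂, ← Matrix.add_mul, ← Matrix.mul_add, hp, Matrix.mul_add, Matrix.add_mul]

/-- `(θ^𝔻 p)|_Δ = Ã · p|_Δ · Ã⁻¹`. [cite: Kudla1994, §2 (doubled space, Siegel parabolic), Thm. 3.1] -/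
theorem deltaBlock_thetaD (a : GL (Fin N) (AdeleRing (𝓞 L) L))
    (ha : ((a : Matrix (Fin N) (Fin N) (AdeleRing (𝓞 L) L)).map (conjAdele (Fp L) L (IsCMField.complexConj L)))ᵀ *
        adelicForm L N (Matrix.diagonal dV) * a = adelicForm L N (Matrix.diagonal dV')) (p : HA L e dV' hdV' dW hdW) :
    deltaBlock L e dV hdV dW hdW (thetaD L e dV hdV dV' hdV' dW hdW a ha p) =
      ((kronA e a : GL (Fin n) (AdeleRing (𝓞 L) L)) : Matrix (Fin n) (Fin n) (AdeleRing (𝓞 L) L)) * deltaBlock L e dV' hdV' dW hdW p *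
        (((kronA e a)⁻¹ : GL (Fin n) (AdeleRing (𝓞 L) L)) : Matrix (Fin n) (Fin n) (AdeleRing (𝓞 L) L)) := by
  unfold deltaBlock
  rw [blk_thetaD_eq_fromBlocks, Matrix.toBlocks_fromBlocks₁₁, Matrix.toBlocks_fromBlocks₁₂, ← Matrix.add_mul, ← Matrix.mul_add]

/-- **`det_Δ (θ^𝔻 p) = det_Δ p`** (B-p08's `hθdet`, unconditionally in `p`). [cite: Kudla1994, §2 (doubled space, Siegel parabolic), Thm. 3.1] -/
theorem detDelta_thetaD (a : GL (Fin N) (AdeleRing (𝓞 L) L))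
    (ha : ((a : Matrix (Fin N) (Fin N) (AdeleRing (𝓞 L) L)).map (conjAdele (Fp L) L (IsCMField.complexConj L)))ᵀ *
        adelicForm L N (Matrix.diagonal dV) * a = adelicForm L N (Matrix.diagonal dV')) (p : HA L e dV' hdV' dW hdW) :
    detDelta L e dV hdV dW hdW (thetaD L e dV hdV dV' hdV' dW hdW a ha p) = detDelta L e dV' hdV' dW hdW p := by
  unfold detDelta
  rw [deltaBlock_thetaD, Matrix.det_units_conj]

/-- B-p08's `hθdet` in its literal (conditional) shape. [cite: Kudla1994, §2 (doubled space, Siegel parabolic), Thm. 3.1] -/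
theorem detDelta_thetaD_of_isSiegelDelta (a : GL (Fin N) (AdeleRing (𝓞 L) L))
    (ha : ((a : Matrix (Fin N) (Fin N) (AdeleRing (𝓞 L) L)).map (conjAdele (Fp L) L (IsCMField.complexConj L)))ᵀ *
        adelicForm L N (Matrix.diagonal dV) * a = adelicForm L N (Matrix.diagonal dV')) :
    ∀ p, IsSiegelDelta L e dV' hdV' dW hdW p →
      detDelta L e dV hdV dW hdW (thetaD L e dV hdV dV' hdV' dW hdW a ha p) = detDelta L e dV' hdV' dW hdW p :=
  fun p _ => detDelta_thetaD a ha p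

end Theta



/-! # §4 The doubled see-saw element `seesawD = Res(kronAD) ∘ Λ_{relabCD}⁻¹`, its Weil lift `rD`, and B-p08's `hθsq` -/

section Doubled

/-- base change commutes with `kronA`: `kronA e (a₀ ⊗ 1) = (kronA e a₀) ⊗ 1`. [cite: PlatonovRapinchuk1994, §5.1] -/
theorem coe_kronA_map {S S' : Type*} [CommRing S] [CommRing S'] (f : S →+* S') (a : GL (Fin N) S) {a' : GL (Fin N) S'}
    (h : (a' : Matrix (Fin N) (Fin N) S') = (a : Matrix (Fin N) (Fin N) S).map f) :
    ((kronA e a' : GL (Fin n) S') : Matrix (Fin n) (Fin n) S') = ((kronA e a : GL (Fin n) S) : Matrix (Fin n) (Fin n) S).map f := by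
  rw [kronA_def, kronA_def, coe_reindexGL, coe_reindexGL, coe_kroneckerGL, coe_kroneckerGL, Units.val_one, Units.val_one, h,
    reindex_map, ← kronecker_map_map, Matrix.map_one f (map_zero f) (map_one f)]

/-- base change commutes with `kronAD`. [cite: PlatonovRapinchuk1994, §5.1] -/
theorem coe_kronAD_map {S S' : Type*} [CommRing S] [CommRing S'] (f : S →+* S') (a : GL (Fin N) S) {a' : GL (Fin N) S'}
    (h : (a' : Matrix (Fin N) (Fin N) S') = (a : Matrix (Fin N) (Fin N) S).map f) :
    ((kronAD e a' : GL (Fin (n + n)) S') : Matrix (Fin (n + n)) (Fin (n + n)) S') =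
      ((kronAD e a : GL (Fin (n + n)) S) : Matrix (Fin (n + n)) (Fin (n + n)) S).map f := by
  rw [kronAD_def, kronAD_def]
  exact coe_reindexGL_blockDiagGL_map f _ _ _ (coe_kronA_map e f a h) (coe_kronA_map e f a h)

/-- base change commutes with `relabC`. [cite: PlatonovRapinchuk1994, §5.1] -/
theorem coe_relabC_map {S S' : Type*} [CommRing S] [CommRing S'] (f : S →+* S') (C : GL (Fin N × Fin M) S)
    {C' : GL (Fin N × Fin M) S'} (h : (C' : Matrix (Fin N × Fin M) (Fin N × Fin M) S') = (C : Matrix (Fin N × Fin M) (Fin N × Fin M) S).map f) :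
    ((relabC e C' : GL (Fin n) S') : Matrix (Fin n) (Fin n) S') = ((relabC e C : GL (Fin n) S) : Matrix (Fin n) (Fin n) S).map f := by
  rw [relabC_def, relabC_def, coe_reindexGL, coe_reindexGL, reindex_map, h]

/-- base change commutes with `relabCD`. [cite: PlatonovRapinchuk1994, §5.1] -/
theorem coe_relabCD_map {S S' : Type*} [CommRing S] [CommRing S'] (f : S →+* S') (C : GL (Fin N × Fin M) S)
    {C' : GL (Fin N × Fin M) S'} (h : (C' : Matrix (Fin N × Fin M) (Fin N × Fin M) S') = (C : Matrix (Fin N × Fin M) (Fin N × Fin M) S).map f) :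
    ((relabCD e C' : GL (Fin (n + n)) S') : Matrix (Fin (n + n)) (Fin (n + n)) S') =
      ((relabCD e C : GL (Fin (n + n)) S) : Matrix (Fin (n + n)) (Fin (n + n)) S).map f := by
  rw [relabCD_def, relabCD_def]
  exact coe_reindexGL_blockDiagGL_map f _ _ _ (coe_relabC_map e f C h) (coe_relabC_map e f C h)

/-- **`h₀^𝔻 := Res((a ⊗ 1) ⊕ (a ⊗ 1)) ∘ Λ_{C̃ ⊕ C̃}⁻¹ ∈ Sp(𝕎^𝔻)(𝔸_{L⁺})`** — the see-saw conjugation element of the DOUBLED hermitian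
space for the isometry `kronAD` and the relabelling `relabCD` (★ `IsQuadraticCoordinates.seesawConj` at `T = T^𝔻 ⊗ 1 = gramDA`,
`H = J^𝔻_𝔸`, the casts of ★ `toSpD`). [cite: Kudla1984, §1] [cite: Kudla1994, §2 (doubled space, Siegel parabolic), Thm. 3.1] -/
def seesawD (a : GL (Fin N) (AdeleRing (𝓞 L) L))
    (ha : ((a : Matrix (Fin N) (Fin N) (AdeleRing (𝓞 L) L)).map (conjAdele (Fp L) L (IsCMField.complexConj L)))ᵀ *
        adelicForm L N (Matrix.diagonal dV) * a = adelicForm L N (Matrix.diagonal dV'))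
    (C : GL (Fin N × Fin M) (AdeleRing (𝓞 (Fp L)) (Fp L)))
    (hC : (realDiagonal L dV hdV).map (algebraMap (Fp L) (AdeleRing (𝓞 (Fp L)) (Fp L))) ⊗ₖ (realDiagonal L dW hdW).map (algebraMap (Fp L) (AdeleRing (𝓞 (Fp L)) (Fp L))) *
        (C : Matrix (Fin N × Fin M) (Fin N × Fin M) (AdeleRing (𝓞 (Fp L)) (Fp L))) =
      (realDiagonal L dV' hdV').map (algebraMap (Fp L) (AdeleRing (𝓞 (Fp L)) (Fp L))) ⊗ₖ (realDiagonal L dW hdW).map (algebraMap (Fp L) (AdeleRing (𝓞 (Fp L)) (Fp L)))) :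
    symplecticGroup (polar (adelicForm (Fp L) (Fin (n + n)) (gramDA L e dV hdV dW hdW))) :=
  (qc L).seesawConj (Fin (n + n)) ((gramD_isSymm L e dV hdV dW hdW).map _) ((gramD_isSymm L e dV' hdV' dW hdW).map _)
    (σ := conjAdele (Fp L) L (IsCMField.complexConj L)) (fun x => by rw [conjAdele_apply, AdeleRing.smul_baseChange])
    (by rw [← algebraMap_conj, RingHom.coe_coe, complexConj_imagUnit L, map_neg])
    (adelicForm_eq_map_map L (n + n) (gramD L e dV hdV dW hdW) (J := hermD L e dV hdV dW hdW) rfl)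
    (adelicForm_eq_map_map L (n + n) (gramD L e dV' hdV' dW hdW) (J := hermD L e dV' hdV' dW hdW) rfl)
    (kronAD e a) (kronAD_isometry L e dV hdV dV' hdV' dW hdW a ha) (relabCD e C)
    (gramDA_mul_relabCD L e dV hdV dV' hdV' dW hdW C hC)

-- (no local notation inside `variable` binders: a notation capturing the section variable `L` elaborates to `sorry` there)
variable {a : GL (Fin N) (AdeleRing (𝓞 L) L)} {a₀ : GL (Fin N) L}
  (haa₀ : (a : Matrix (Fin N) (Fin N) (AdeleRing (𝓞 L) L)) =
    ((a₀ : GL (Fin N) L) : Matrix (Fin N) (Fin N) L).map (algebraMap L (AdeleRing (𝓞 L) L)))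
  (ha : ((a : Matrix (Fin N) (Fin N) (AdeleRing (𝓞 L) L)).map (conjAdele (Fp L) L (IsCMField.complexConj L)))ᵀ *
      adelicForm L N (Matrix.diagonal dV) * a = adelicForm L N (Matrix.diagonal dV'))
  {C : GL (Fin N × Fin M) (AdeleRing (𝓞 (Fp L)) (Fp L))} {C₀ : GL (Fin N × Fin M) (Fp L)}
  (hCC₀ : (C : Matrix (Fin N × Fin M) (Fin N × Fin M) (AdeleRing (𝓞 (Fp L)) (Fp L))) =
    ((C₀ : GL (Fin N × Fin M) (Fp L)) : Matrix (Fin N × Fin M) (Fin N × Fin M) (Fp L)).map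
      (algebraMap (Fp L) (AdeleRing (𝓞 (Fp L)) (Fp L))))
  (hC : (realDiagonal L dV hdV).map (algebraMap (Fp L) (AdeleRing (𝓞 (Fp L)) (Fp L))) ⊗ₖ
        (realDiagonal L dW hdW).map (algebraMap (Fp L) (AdeleRing (𝓞 (Fp L)) (Fp L))) *
      (C : Matrix (Fin N × Fin M) (Fin N × Fin M) (AdeleRing (𝓞 (Fp L)) (Fp L))) =
    (realDiagonal L dV' hdV').map (algebraMap (Fp L) (AdeleRing (𝓞 (Fp L)) (Fp L))) ⊗ₖ
      (realDiagonal L dW hdW).map (algebraMap (Fp L) (AdeleRing (𝓞 (Fp L)) (Fp L))))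

include hdV0 hdW0 haa₀ hCC₀ in
/-- **`h₀^𝔻` of rational data is `L⁺`-rational** (★ `seesawConj_adele_mem_range` at `T₀ = T^𝔻`, `g₀ = kronAD e a₀`, `C₀ = relabCD e C₀`) —
the hypothesis of Weil's Θ-fixing rational lift. [cite: Weil1964, Chap. III n° 41 Thm 6 p. 193] [cite: GelbartRogawski1991, §3.1 p. 454] -/
theorem seesawD_mem_range :
    seesawD L e dV hdV dV' hdV' dW hdW a ha C hC ∈
      ((transportSp (gramDA L e dV hdV dW hdW) (isUnit_det_gramDA L e dV hdV hdV0 dW hdW hdW0)).comp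
        (mapHom (algebraMap (Fp L) (AdeleRing (𝓞 (Fp L)) (Fp L))))).range :=
  seesawConj_adele_mem_range (Fp L) L (IsCMField.complexConj L) (complexConj_imagUnit L) (imagUnit_ne_zero L)
    (imagUnit_mul_self L) (gramD_isSymm L e dV hdV dW hdW) (gramD_isSymm L e dV' hdV' dW hdW)
    (isUnit_det_gramD L e dV hdV hdV0 dW hdW hdW0) rfl rfl ((gramD_isSymm L e dV hdV dW hdW).map _)
    ((gramD_isSymm L e dV' hdV' dW hdW).map _) (isUnit_det_gramDA L e dV hdV hdV0 dW hdW hdW0)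
    (adelicForm_eq_map_map L (n + n) (gramD L e dV hdV dW hdW) (J := hermD L e dV hdV dW hdW) rfl)
    (adelicForm_eq_map_map L (n + n) (gramD L e dV' hdV' dW hdW) (J := hermD L e dV' hdV' dW hdW) rfl)
    (g₀ := kronAD e a₀) (coe_kronAD_map e (algebraMap L (AdeleRing (𝓞 L) L)) a₀ haa₀) (kronAD_isometry L e dV hdV dV' hdV' dW hdW a ha)
    (C₀ := relabCD e C₀) (coe_relabCD_map e (algebraMap (Fp L) (AdeleRing (𝓞 (Fp L)) (Fp L))) C₀ hCC₀) (gramDA_mul_relabCD L e dV hdV dV' hdV' dW hdW C hC)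

/-- **`r^𝔻 := r_{L⁺}(h₀^𝔻) ∈ Mp(𝕎^𝔻)ᶜᵒⁿᵗ`** — Weil's Θ-fixing rational lift of the doubled see-saw element (B-p08's (T4) binder `r`,
(T4u)'s `rD`). [cite: Weil1964, Chap. III n° 41 Thm 6 p. 193] [cite: GelbartRogawski1991, §3.1 p. 454] -/
def rD : MpD L e dV hdV dW hdW :=
  ratPointsThetaLiftCont (Fp L) (Fin (n + n)) (gramDA L e dV hdV dW hdW) (isUnit_det_gramDA L e dV hdV hdV0 dW hdW hdW0)
    ⟨seesawD L e dV hdV dV' hdV' dW hdW a ha C hC,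
      seesawD_mem_range L e dV hdV hdV0 dV' hdV' dW hdW hdW0 haa₀ ha hCC₀ hC⟩

/-- `π(r^𝔻) = h₀^𝔻`. [cite: Weil1964, Chap. III n° 40 p. 190] -/
theorem projD_rD :
    projD L e dV hdV dW hdW (rD L e dV hdV hdV0 dV' hdV' dW hdW hdW0 haa₀ ha hCC₀ hC) =
      seesawD L e dV hdV dV' hdV' dW hdW a ha C hC :=
  proj_ratPointsThetaLiftCont (Fp L) (Fin (n + n)) _ _ _

/-- `r^𝔻` is Θ-fixing (B-p08's `hr`). [cite: Weil1964, Chap. III n° 41 Thm 6 p. 193] -/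
theorem rD_mem_adelicMpTheta :
    ((rD L e dV hdV hdV0 dV' hdV' dW hdW hdW0 haa₀ ha hCC₀ hC : MpD L e dV hdV dW hdW) :
        adelicMp (Fp L) (Fin (n + n)) (gramDA L e dV hdV dW hdW)) ∈
      adelicMpTheta (Fp L) (Fin (n + n)) (gramDA L e dV hdV dW hdW) :=
  coe_ratPointsThetaLiftCont_mem_adelicMpTheta (Fp L) (Fin (n + n)) _ _ _

/-- `undoubleIdx r^𝔻` is Θ-fixing ((T4u) §B `hθD`, token for token). [cite: Weil1964, Chap. III n° 41 Thm 6 p. 193] -/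
theorem undoubleIdx_rD_mem_adelicMpTheta :
    ((undoubleIdx L e dV hdV dW hdW (rD L e dV hdV hdV0 dV' hdV' dW hdW hdW0 haa₀ ha hCC₀ hC) :
        adelicMpCont (Fp L) (Fin n ⊕ Fin n) (gramS L e dV hdV dW hdW)) :
        adelicMp (Fp L) (Fin n ⊕ Fin n) (gramS L e dV hdV dW hdW)) ∈
      adelicMpTheta (Fp L) (Fin n ⊕ Fin n) (gramS L e dV hdV dW hdW) :=
  (undoubleIdx_mem_adelicMpTheta_iff L e dV hdV dW hdW _).2
    (rD_mem_adelicMpTheta L e dV hdV hdV0 dV' hdV' dW hdW hdW0 haa₀ ha hCC₀ hC)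

/-- **B-p08's `hθsq` IN THE MODEL, TOKEN FOR TOKEN**: `π(r^𝔻) · Congr_{Λ_{C^𝔻}}(ι′^𝔻 h) · π(r^𝔻)⁻¹ = ι^𝔻(θ^𝔻 h)` for all `h ∈ H′(𝔸)`
(★ `seesawConj_conj_toSymplectic`; `toSpD` is `toSymplectic` of `T^𝔻`). [cite: Kudla1984, §1] [cite: Kudla1994, §2 (doubled space, Siegel parabolic), Thm. 3.1] -/
theorem thetaD_square (h : HA L e dV' hdV' dW hdW) :
    projD L e dV hdV dW hdW (rD L e dV hdV hdV0 dV' hdV' dW hdW hdW0 haa₀ ha hCC₀ hC) *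
        symplecticGroupCongr (polar (adelicForm (Fp L) (Fin (n + n)) (gramDA L e dV' hdV' dW hdW)))
          (polar (adelicForm (Fp L) (Fin (n + n)) (gramDA L e dV hdV dW hdW)))
          (relabelVec (Fp L) (Fin (n + n)) (relabCD e C))
          (polar_relabelVec (Fp L) (Fin (n + n)) (relabCD e C) (gramDA_mul_relabCD L e dV hdV dV' hdV' dW hdW C hC))
          (toSpD L e dV' hdV' dW hdW h) *
      (projD L e dV hdV dW hdW (rD L e dV hdV hdV0 dV' hdV' dW hdW hdW0 haa₀ ha hCC₀ hC))⁻¹ =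
    toSpD L e dV hdV dW hdW (thetaD L e dV hdV dV' hdV' dW hdW a ha h) := by
  rw [projD_rD]
  exact (qc L).seesawConj_conj_toSymplectic (Fin (n + n)) _ _ _ _ _ _ _ _ (relabCD e C)
    (gramDA_mul_relabCD L e dV hdV dV' hdV' dW hdW C hC) h

end Doubled

end Literature.NumberTheory.GelbartRogawski1991.GRConstruction

end
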